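import Summits.NavierStokesRegularity.NavierStokesRegularity.Theorems.FilamentSkeletonRssSkeletonJ1RSlipTools

/-!
# Route `FilamentSkeletonRss` · crux `SkeletonJ1R` (stmt-NavierStokesRegularity-23610) · stub D `FlatOutputL` — TOOLS II: the OTHER STRANDS
# (far field, uniform along the arm) and the tangential centreline bound for a finite skeleton

Companion of `…SkeletonJ1RSlipTools`.  §3: the far-field / mutual-induction bound of the landed tools stub `stub_biotSavartFarField`
(`…SkeletonEquilibriumBiotSavartFarField`, line `Sketch` of crux `SkeletonEquilibrium`; carried here as a PRIVATE adapted copy `sjf_biotSavartFarField`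
with its four private helpers because the hub holds no `.olean` for that module — gate build backlog 2026-08-29 — to be re-imported by name once built)
RE-CENTRED at the point of closest approach (`Continuous.exists_forall_le`) gives the UNIFORM bound
`‖∫ ((‖y − Xσ‖² + e²)^{3/2})⁻¹ • X′σ × (y − Xσ) dσ‖ ≤ 16/(c d)` for EVERY point `y` at distance `≥ d` from a chord–arc curve, independent of `‖y‖`
(`norm_biotSavart_le_of_separated`).  §4: summing over a finite skeleton (`abs_inner_skeletonField_le`): for `C²` unit-speed filaments with
curvature `≤ κ₀`, chord–arc constant `c ∈ (0,1]`, separation `≥ d`, `|γ_k| ≤ G`, `0 ≤ Γ`: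
`|⟪Σ_k (Γγ_k/4π) ∫ K • X_k′σ × (X_jτ − X_kσ) dσ, X_j′τ⟫| ≤ N·(ΓG/(4π))·(2πκ₀/c³ + 16/(c d))`, uniformly in `τ`.
HONEST FRAMING: MODEL rung, ∃-side tools about a HYPOTHETICAL filament-type blow-up skeleton; elementary real analysis; nothing here bears on
Navier–Stokes regularity, which is NOT proved. [folklore]
-/

-- `dupNamespace` off: the module name repeats `NavierStokesRegularity` by the tree's `Summits/<S>/<S>/Theorems` layout (same as every sibling file).
set_option linter.dupNamespace false

noncomputable section

namespace Summit.NavierStokesRegularity.NavierStokesRegularity.Theorems.SkeletonJ1RSlipTools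

open MeasureTheory Filter Topology
open Literature.Analysis.FluidPDE Literature.Analysis.FluidPDE.Tao2016
open scoped RealInnerProductSpace InnerProductSpace BigOperators

/-! ## §3a The far-field brick (private adapted copy of `…SkeletonEquilibriumBiotSavartFarField`) -/

/-- `‖v × w‖ ≤ ‖v‖ ‖w‖` (from `norm_cross`, `sin ≤ 1`). [folklore] -/
private theorem sjf_norm_cross_le (v w : EuclideanSpace ℝ (Fin 3)) :
    ‖cross v w‖ ≤ ‖v‖ * ‖w‖ := by
  -- adapted from FilamentSkeletonRssSkeletonEquilibriumKernelIntegrable (rosenhead_norm_cross_le)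
  rw [norm_cross]
  exact mul_le_of_le_one_right (by positivity) (Real.sin_le_one _)

/-- `b ^ (3/2) = b √b` for `0 < b`. [folklore] -/
private theorem sjf_rpow_three_halves {b : ℝ} (hb : 0 < b) :
    b ^ (3 / 2 : ℝ) = b * Real.sqrt b := by
  rw [show (3 / 2 : ℝ) = 1 + 1 / 2 by norm_num, Real.rpow_add hb, Real.rpow_one, Real.sqrt_eq_rpow]

/-- The `e`-uniform scalar kernel bound `r / (r² + e²)^{3/2} ≤ (r²)⁻¹` for `0 < r`
(since `r² ≤ r² + e²` and `r ≤ √(r² + e²)`). [folklore] -/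
private theorem sjf_kernel_mul_le_inv_sq {r : ℝ} (hr : 0 < r) (e : ℝ) :
    ((r ^ 2 + e ^ 2) ^ (3 / 2 : ℝ))⁻¹ * r ≤ (r ^ 2)⁻¹ := by
  have hb : 0 < r ^ 2 + e ^ 2 := by positivity
  have hs : 0 < Real.sqrt (r ^ 2 + e ^ 2) := Real.sqrt_pos.2 hb
  have h1 : r ^ 2 ≤ r ^ 2 + e ^ 2 := by nlinarith [sq_nonneg e]
  have h2 : r ≤ Real.sqrt (r ^ 2 + e ^ 2) := Real.le_sqrt_of_sq_le h1
  rw [sjf_rpow_three_halves hb, inv_mul_le_iff₀ (mul_pos hb hs), le_mul_inv_iff₀ (pow_pos hr 2)]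
  calc r * r ^ 2 = r ^ 2 * r := mul_comm _ _
    _ ≤ (r ^ 2 + e ^ 2) * Real.sqrt (r ^ 2 + e ^ 2) := mul_le_mul h1 h2 hr.le hb.le

/-- The elementary inequality behind the majorant: if `0 < d ≤ r`, `0 ≤ A`, `0 < c` and
`c |u| − A ≤ r`, then `|d · (c / (d + A)) · u| ≤ r`, i.e. `d c |u| ≤ (d + A) r`
(case split on `c |u| ≤ d + A`). [folklore] -/
private theorem sjf_abs_scaled_le {d A c u r : ℝ} (hd : 0 < d) (hA : 0 ≤ A) (hc : 0 < c)
    (hdr : d ≤ r) (hur : c * |u| - A ≤ r) : |d * (c / (d + A) * u)| ≤ r := by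
  have hdA : 0 < d + A := by linarith
  have key : d * (c * |u|) ≤ r * (d + A) := by
    rcases le_or_gt (c * |u|) (d + A) with h | h
    · nlinarith [mul_nonneg (sub_nonneg.2 hdr) hdA.le, mul_nonneg hd.le (sub_nonneg.2 h)]
    · nlinarith [mul_nonneg (sub_nonneg.2 hur) hdA.le, mul_nonneg hA (sub_nonneg.2 h.le)]
  rw [abs_mul, abs_of_pos hd, abs_mul, abs_of_pos (div_pos hc hdA), div_mul_eq_mul_div,
    mul_div_assoc', div_le_iff₀ hdA]
  exact key

/-- The Cauchy-type majorant: if `0 < d`, `(d k)² ≤ r²` and `d² ≤ r²`, then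
`(r²)⁻¹ ≤ (2 / d²) (1 + k²)⁻¹` (as `d² (1 + k²) = d² + (d k)² ≤ 2 r²`). [folklore] -/
private theorem sjf_inv_sq_le_majorant {d k r : ℝ} (hd : 0 < d) (h1 : (d * k) ^ 2 ≤ r ^ 2)
    (h2 : d ^ 2 ≤ r ^ 2) : (r ^ 2)⁻¹ ≤ 2 / d ^ 2 * (1 + k ^ 2)⁻¹ := by
  have hr2 : 0 < r ^ 2 := lt_of_lt_of_le (pow_pos hd 2) h2
  rw [← div_eq_mul_inv, div_div, inv_eq_one_div, div_le_div_iff₀ hr2 (by positivity)]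
  nlinarith [h1, h2]

/-- The value of the majorant's integral: for `0 < d`, `0 < c`, `0 < d + A`,
`∫ (2 / d²) (1 + (c u / (d + A))²)⁻¹ du = (2 / d²) · ((d + A) / c) · π`
(substitution in `∫ (1 + u²)⁻¹ = π`). [folklore] -/
private theorem sjf_integral_majorant {d A c : ℝ} (hc : 0 < c) (hdA : 0 < d + A) :
    ∫ u : ℝ, 2 / d ^ 2 * (1 + (c / (d + A) * u) ^ 2)⁻¹ = 2 / d ^ 2 * ((d + A) / c * Real.pi) := by
  rw [MeasureTheory.integral_const_mul, Measure.integral_comp_mul_left (fun y : ℝ => (1 + y ^ 2)⁻¹),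
    integral_univ_inv_one_add_sq, smul_eq_mul, inv_div, abs_of_pos (div_pos hdA hc)]

/-- PRIVATE adapted copy of the landed tools stub `stub_biotSavartFarField` (`…SkeletonEquilibriumBiotSavartFarField`, no hub olean 2026-08-29): the far-field / mutual-induction bound for the
regularised Biot–Savart field of a filament. For `c > 0`, `d > 0`, a curve `X : ℝ → ℝ³` with
`‖X′‖ ≤ 1` and linear growth `c |u| − C ≤ ‖X u‖`, and a point `x` with `‖x − X u‖ ≥ d` for all
`u`, the field `∫ ((‖x − X u‖² + e²)^{3/2})⁻¹ • X′(u) × (x − X u) du` has norm at most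
`8 ((|C| + ‖x‖) / (c d²) + 1 / (c d))`, uniformly in the core parameter `e` (pointwise bound
`r⁻²`, Cauchy majorant `(2/d²)(1 + (c u /(d + |C| + ‖x‖))²)⁻¹`, `π ≤ 4`). [folklore] -/
private theorem sjf_biotSavartFarField :
    ∀ (e c C d : ℝ) (X : ℝ → EuclideanSpace ℝ (Fin 3)) (x : EuclideanSpace ℝ (Fin 3)),
      e ≠ 0 → 0 < c → 0 < d → ContDiff ℝ 1 X → (∀ u, ‖deriv X u‖ ≤ 1) →
      (∀ u, c * |u| - C ≤ ‖X u‖) → (∀ u, d ≤ ‖x - X u‖) →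
      ‖∫ u : ℝ, ((‖x - X u‖ ^ 2 + e ^ 2) ^ (3 / 2 : ℝ))⁻¹ • cross (deriv X u) (x - X u)‖
        ≤ 8 * ((|C| + ‖x‖) / (c * d ^ 2) + 1 / (c * d)) := by
  intro e c C d X x _he hc hd _hX hdX hgrow hfar
  have hA : 0 ≤ |C| + ‖x‖ := by positivity
  have hdA : 0 < d + (|C| + ‖x‖) := by positivity
  have hg_int : Integrable
      (fun u : ℝ => 2 / d ^ 2 * (1 + (c / (d + (|C| + ‖x‖)) * u) ^ 2)⁻¹) :=
    (integrable_inv_one_add_sq.comp_mul_left' (div_pos hc hdA).ne').const_mul _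
  have hbound : ∀ u : ℝ,
      ‖((‖x - X u‖ ^ 2 + e ^ 2) ^ (3 / 2 : ℝ))⁻¹ • cross (deriv X u) (x - X u)‖
        ≤ 2 / d ^ 2 * (1 + (c / (d + (|C| + ‖x‖)) * u) ^ 2)⁻¹ := by
    intro u
    have hr : d ≤ ‖x - X u‖ := hfar u
    have hrpos : 0 < ‖x - X u‖ := lt_of_lt_of_le hd hr
    have hur : c * |u| - (|C| + ‖x‖) ≤ ‖x - X u‖ := by
      have h1 := hgrow u
      have h2 : ‖X u‖ - ‖x‖ ≤ ‖x - X u‖ := by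
        rw [norm_sub_rev]
        exact norm_sub_norm_le _ _
      have h3 : C ≤ |C| := le_abs_self C
      linarith
    have hb : 0 < ‖x - X u‖ ^ 2 + e ^ 2 := by positivity
    have hsq : (d * (c / (d + (|C| + ‖x‖)) * u)) ^ 2 ≤ ‖x - X u‖ ^ 2 := by
      have h := pow_le_pow_left₀ (abs_nonneg _) (sjf_abs_scaled_le hd hA hc hr hur) 2
      rwa [sq_abs] at h
    rw [norm_smul, norm_inv, Real.norm_of_nonneg (Real.rpow_nonneg hb.le _)]
    calc ((‖x - X u‖ ^ 2 + e ^ 2) ^ (3 / 2 : ℝ))⁻¹ * ‖cross (deriv X u) (x - X u)‖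
        ≤ ((‖x - X u‖ ^ 2 + e ^ 2) ^ (3 / 2 : ℝ))⁻¹ * ‖x - X u‖ := by
          refine mul_le_mul_of_nonneg_left ?_ (inv_nonneg.2 (Real.rpow_nonneg hb.le _))
          calc ‖cross (deriv X u) (x - X u)‖ ≤ ‖deriv X u‖ * ‖x - X u‖ :=
                sjf_norm_cross_le _ _
            _ ≤ 1 * ‖x - X u‖ := mul_le_mul_of_nonneg_right (hdX u) (norm_nonneg _)
            _ = ‖x - X u‖ := one_mul _
      _ ≤ (‖x - X u‖ ^ 2)⁻¹ := sjf_kernel_mul_le_inv_sq hrpos e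
      _ ≤ 2 / d ^ 2 * (1 + (c / (d + (|C| + ‖x‖)) * u) ^ 2)⁻¹ :=
          sjf_inv_sq_le_majorant hd hsq (pow_le_pow_left₀ hd.le hr 2)
  have hc' : c ≠ 0 := hc.ne'
  have hd' : d ≠ 0 := hd.ne'
  have key1 : 2 / d ^ 2 * ((d + (|C| + ‖x‖)) / c * Real.pi)
      = (2 * Real.pi) * ((d + (|C| + ‖x‖)) / (c * d ^ 2)) := by
    field_simp
  have key2 : 8 * ((|C| + ‖x‖) / (c * d ^ 2) + 1 / (c * d))
      = 8 * ((d + (|C| + ‖x‖)) / (c * d ^ 2)) := by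
    field_simp
    ring
  calc ‖∫ u : ℝ, ((‖x - X u‖ ^ 2 + e ^ 2) ^ (3 / 2 : ℝ))⁻¹ • cross (deriv X u) (x - X u)‖
      ≤ ∫ u : ℝ, 2 / d ^ 2 * (1 + (c / (d + (|C| + ‖x‖)) * u) ^ 2)⁻¹ :=
        norm_integral_le_of_norm_le hg_int (Eventually.of_forall hbound)
    _ = 2 / d ^ 2 * ((d + (|C| + ‖x‖)) / c * Real.pi) := sjf_integral_majorant hc hdA
    _ = (2 * Real.pi) * ((d + (|C| + ‖x‖)) / (c * d ^ 2)) := key1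
    _ ≤ 8 * ((d + (|C| + ‖x‖)) / (c * d ^ 2)) :=
        mul_le_mul_of_nonneg_right (by linarith [Real.pi_le_four]) (by positivity)
    _ = 8 * ((|C| + ‖x‖) / (c * d ^ 2) + 1 / (c * d)) := key2.symm


/-! ## §3 Other strands: the far field, uniformly along the arm -/

/-- **Uniform far-field bound.**  For a `C¹` curve with `‖X′‖ ≤ 1` and global chord–arc constant `c > 0`, and a point `y` at
distance `≥ d > 0` from the curve, `‖∫ ((‖y − Xσ‖² + e²)^{3/2})⁻¹ • X′σ × (y − Xσ) dσ‖ ≤ 16/(c d)` — independent of `‖y‖`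
(the landed `stub_biotSavartFarField` re-centred at the point of closest approach). [folklore] -/
theorem norm_biotSavart_le_of_separated {X : ℝ → EuclideanSpace ℝ (Fin 3)} (hX : ContDiff ℝ 1 X)
    (hd1 : ∀ u, ‖deriv X u‖ ≤ 1) {c d e : ℝ} (hc : 0 < c) (hchord : ∀ u t, c * |u - t| ≤ ‖X u - X t‖) (hd : 0 < d)
    (he : e ≠ 0) {y : EuclideanSpace ℝ (Fin 3)} (hfar : ∀ u, d ≤ ‖y - X u‖) :
    ‖∫ σ : ℝ, ((‖y - X σ‖ ^ 2 + e ^ 2) ^ (3 / 2 : ℝ))⁻¹ • cross (deriv X σ) (y - X σ)‖ ≤ 16 / (c * d) := by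
  -- the point of closest approach
  have hcont : Continuous fun u => ‖y - X u‖ := (continuous_const.sub hX.continuous).norm
  have htend : Tendsto (fun u => ‖y - X u‖) (cocompact ℝ) atTop := by
    have hlow : ∀ u, c * ‖u‖ + (-(‖X 0‖ + ‖y‖)) ≤ ‖y - X u‖ := by
      intro u
      have h1 := hchord u 0
      rw [sub_zero, ← Real.norm_eq_abs] at h1
      have h2 : ‖X u - X 0‖ ≤ ‖y - X u‖ + ‖y‖ + ‖X 0‖ := by
        calc ‖X u - X 0‖ = ‖(y - X 0) - (y - X u)‖ := by congr 1; abel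
          _ ≤ ‖y - X 0‖ + ‖y - X u‖ := norm_sub_le _ _
          _ ≤ ‖y‖ + ‖X 0‖ + ‖y - X u‖ := by linarith [norm_sub_le y (X 0)]
          _ = ‖y - X u‖ + ‖y‖ + ‖X 0‖ := by ring
      linarith
    refine tendsto_atTop_mono hlow ?_
    exact tendsto_atTop_add_const_right _ _ (Tendsto.const_mul_atTop hc tendsto_norm_cocompact_atTop)
  obtain ⟨u₀, hu₀⟩ := hcont.exists_forall_le htend
  set D₀ := ‖y - X u₀‖ with hD₀
  have hD₀d : d ≤ D₀ := hfar u₀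
  have hD₀pos : 0 < D₀ := lt_of_lt_of_le hd hD₀d
  -- the re-centred curve
  set Xs : ℝ → EuclideanSpace ℝ (Fin 3) := fun u => X (u + u₀) - y with hXs
  have hXs_cd : ContDiff ℝ 1 Xs := (hX.comp (contDiff_id.add contDiff_const)).sub contDiff_const
  have hXs_deriv : ∀ u, deriv Xs u = deriv X (u + u₀) := by
    intro u
    rw [hXs, deriv_sub_const, deriv_comp_add_const]
  have hXs_d1 : ∀ u, ‖deriv Xs u‖ ≤ 1 := fun u => by rw [hXs_deriv]; exact hd1 _
  have hXs_grow : ∀ u, c * |u| - D₀ ≤ ‖Xs u‖ := by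
    intro u
    have h1 := hchord (u + u₀) u₀
    rw [add_sub_cancel_right] at h1
    have h2 : ‖X (u + u₀) - X u₀‖ ≤ ‖X (u + u₀) - y‖ + ‖y - X u₀‖ := by
      calc ‖X (u + u₀) - X u₀‖ = ‖(X (u + u₀) - y) + (y - X u₀)‖ := by congr 1; abel
        _ ≤ _ := norm_add_le _ _
    show c * |u| - D₀ ≤ ‖X (u + u₀) - y‖
    linarith
  have hXs_far : ∀ u, D₀ ≤ ‖(0 : EuclideanSpace ℝ (Fin 3)) - Xs u‖ := by
    intro u
    rw [zero_sub, norm_neg, hXs, norm_sub_rev]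
    exact hu₀ _
  have hbrick := sjf_biotSavartFarField e c D₀ D₀ Xs 0 he hc hD₀pos hXs_cd hXs_d1 hXs_grow hXs_far
  -- identify the integrals (translation invariance of Lebesgue measure)
  set F : ℝ → EuclideanSpace ℝ (Fin 3) :=
    fun σ => ((‖y - X σ‖ ^ 2 + e ^ 2) ^ (3 / 2 : ℝ))⁻¹ • cross (deriv X σ) (y - X σ) with hF
  have hident : ∫ u : ℝ, ((‖(0 : EuclideanSpace ℝ (Fin 3)) - Xs u‖ ^ 2 + e ^ 2) ^ (3 / 2 : ℝ))⁻¹ •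
        cross (deriv Xs u) ((0 : EuclideanSpace ℝ (Fin 3)) - Xs u) = ∫ σ : ℝ, F σ := by
    have h1 : (fun u : ℝ => ((‖(0 : EuclideanSpace ℝ (Fin 3)) - Xs u‖ ^ 2 + e ^ 2) ^ (3 / 2 : ℝ))⁻¹ •
        cross (deriv Xs u) ((0 : EuclideanSpace ℝ (Fin 3)) - Xs u)) = fun u : ℝ => F (u + u₀) := by
      funext u
      have : (0 : EuclideanSpace ℝ (Fin 3)) - Xs u = y - X (u + u₀) := by rw [hXs]; simp
      rw [this, hXs_deriv]
    rw [h1]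
    exact integral_add_right_eq_self F u₀
  rw [← hident]
  refine hbrick.trans ?_
  rw [norm_zero, add_zero, abs_of_pos hD₀pos]
  have : 8 * (D₀ / (c * D₀ ^ 2) + 1 / (c * D₀)) = 16 / (c * D₀) := by
    field_simp; ring
  rw [this]
  exact div_le_div_of_nonneg_left (by norm_num) (mul_pos hc hd) (mul_le_mul_of_nonneg_left hD₀d hc.le)

/-! ## §4 The finite skeleton: tangential component of the full regularised Biot–Savart field -/

/-- **Tangential centreline bound for a skeleton.**  For finitely many `C²` unit-speed filaments `X k` with curvature `≤ κ₀`,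
global chord–arc constant `c ∈ (0,1]`, mutual separation `≥ d > 0`, circulation weights `|γ k| ≤ G`, `0 ≤ Γ`, and any core
parameter `e ≠ 0`, the tangential component of the regularised Biot–Savart field of the skeleton along filament `j` obeys
`|⟪Σ_k (Γγ_k/4π) ∫ K • X_k′σ × (X_jτ − X_kσ) dσ, X_j′τ⟫| ≤ N · (ΓG/(4π)) · (2πκ₀/c³ + 16/(c d))`, uniformly in `τ`.
[folklore] -/
theorem abs_inner_skeletonField_le {N : ℕ} {X : Fin N → ℝ → EuclideanSpace ℝ (Fin 3)} (hX : ∀ k, ContDiff ℝ 2 (X k))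
    (hunit : ∀ k s, ‖deriv (X k) s‖ = 1) {κ₀ c d e Γ G : ℝ} {γ : Fin N → ℝ} (hκ₀ : 0 < κ₀)
    (hκ : ∀ k s, ‖deriv (deriv (X k)) s‖ ≤ κ₀) (hc : 0 < c) (hc1 : c ≤ 1)
    (hchord : ∀ k u t, c * |u - t| ≤ ‖X k u - X k t‖) (hd : 0 < d)
    (hsep : ∀ j k, j ≠ k → ∀ τ σ, d ≤ ‖X j τ - X k σ‖) (hγ : ∀ k, |γ k| ≤ G) (hΓ : 0 ≤ Γ) (he : e ≠ 0)
    (j : Fin N) (τ : ℝ) :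
    |⟪∑ k, (Γ * γ k / (4 * Real.pi)) • ∫ σ : ℝ, ((‖X j τ - X k σ‖ ^ 2 + e ^ 2) ^ (3 / 2 : ℝ))⁻¹ •
        cross (deriv (X k) σ) (X j τ - X k σ), deriv (X j) τ⟫| ≤
      N * (Γ * G / (4 * Real.pi) * (2 * Real.pi * κ₀ / c ^ 3 + 16 / (c * d))) := by
  have hG : 0 ≤ G := le_trans (abs_nonneg _) (hγ j)
  have hS : 0 ≤ 2 * Real.pi * κ₀ / c ^ 3 := by positivity
  have hF : 0 ≤ 16 / (c * d) := by positivity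
  rw [sum_inner]
  refine (Finset.abs_sum_le_sum_abs _ _).trans ?_
  have hterm : ∀ k ∈ (Finset.univ : Finset (Fin N)),
      |⟪(Γ * γ k / (4 * Real.pi)) • ∫ σ : ℝ, ((‖X j τ - X k σ‖ ^ 2 + e ^ 2) ^ (3 / 2 : ℝ))⁻¹ •
          cross (deriv (X k) σ) (X j τ - X k σ), deriv (X j) τ⟫| ≤
        Γ * G / (4 * Real.pi) * (2 * Real.pi * κ₀ / c ^ 3 + 16 / (c * d)) := by
    intro k _
    rw [inner_smul_left, RCLike.conj_to_real, abs_mul]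
    have hcoef : |Γ * γ k / (4 * Real.pi)| ≤ Γ * G / (4 * Real.pi) := by
      rw [abs_div, abs_mul, abs_of_nonneg hΓ, abs_of_pos (by positivity : (0:ℝ) < 4 * Real.pi)]
      gcongr
      exact hγ k
    have hin : |⟪∫ σ : ℝ, ((‖X j τ - X k σ‖ ^ 2 + e ^ 2) ^ (3 / 2 : ℝ))⁻¹ • cross (deriv (X k) σ) (X j τ - X k σ),
        deriv (X j) τ⟫| ≤ 2 * Real.pi * κ₀ / c ^ 3 + 16 / (c * d) := by
      by_cases hjk : j = k
      · subst hjk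
        exact (abs_inner_selfInduction_le (hX j) (hunit j) hκ₀ (hκ j) hc hc1 (hchord j) he τ).trans
          (le_add_of_nonneg_right hF)
      · have h1 := norm_biotSavart_le_of_separated ((hX k).of_le (by norm_num)) (fun u => (hunit k u).le) hc
          (hchord k) hd he (y := X j τ) (fun u => hsep j k hjk τ u)
        have h2 := abs_real_inner_le_norm
          (∫ σ : ℝ, ((‖X j τ - X k σ‖ ^ 2 + e ^ 2) ^ (3 / 2 : ℝ))⁻¹ • cross (deriv (X k) σ) (X j τ - X k σ))
          (deriv (X j) τ)
        rw [hunit j τ, mul_one] at h2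
        exact h2.trans (h1.trans (le_add_of_nonneg_left hS))
    exact mul_le_mul hcoef hin (abs_nonneg _) (by positivity)
  refine (Finset.sum_le_sum hterm).trans ?_
  rw [Finset.sum_const, Finset.card_univ, Fintype.card_fin, nsmul_eq_mul]

end Summit.NavierStokesRegularity.NavierStokesRegularity.Theorems.SkeletonJ1RSlipTools

end
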